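import Mathlib
import HarnessLib
import HarnessLib.Audit

/-!
# ValiantsHypothesis / LacunarySymmetroid — crux `MatrixDescartes` (stmt-ValiantsHypothesis-18050, V1), LINE (A) «product_plus_one»:
# the TIE LAW — definitions and the typed statement

Source: pen val-idea-25 g8, NOTE §45 «THE TIE LAW IS A THEOREM» (`pub/ideators/val-idea-25/NOTE-idea25g3-18050-LINEA-AB-reduction.md`
ll. 2350–2384, 2026-08-29), a PAPER theorem refereed PASS by val-idea-crit-1 g10 (#356) and val-lit-p3 g22 (NOTE-p3g22-18050-tiecell §8).

For coprime `1 ≤ a < b`, `c = a + b`, wells `β_f, γ_f > 0` with positive weights `w_f` (`f < T`):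
`m_f = β_f + γ_f X^c`, `n_f = b γ_f X^c − a β_f`, `q_f = m_f² − 2 cos(πa/c) X^a m_f + X^{2a}`, and
`M_T = Σ_f w_f · n_f · ∏_{f' ≠ f} q_{f'}` — the numerator of `d/du Σ_f w_f · arg g_f(e^u e^{iπ/c})`, `g_f(ζ) = γ_f ζ^c + ζ^a − β_f`,
i.e. of the derivative of the LINE's tied-phase wells function.  THE TIE LAW: `M_T` has at most `2T − 1` positive roots counted with
multiplicity (hence the wells function has ≤ `2T − 1` critical points, ≤ `T` pits: (WELLS-GEN″)/(CL-1) at the tie, all shapes, all `T`).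

This file only DEFINES the objects and the statement `TieLaw.Statement : Prop`; the identities of the proof are in
`…TieLawAlgebra`.  HONEST FRAMING: a typed statement of a paper theorem; nothing here proves it; no stub of LINE (A)
(`stub_oneChangeFloorK3` …) is touched; `MatrixDescartes` OPEN; `VP ≠ VNP` is NOT proved.
-/

set_option linter.dupNamespace false

namespace Summit.ValiantsHypothesis.ValiantsHypothesis.Theorems.LacunarySymmetroidMatrixDescartes

namespace TieLaw

open Polynomial

noncomputable section

/-- The well polynomial `m = β + γ X^c` (so the well is `y(u) = m(e^u)/e^{au} = β e^{−au} + γ e^{bu}`). -/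
def mPoly (c : ℕ) (β γ : ℝ) : ℝ[X] := C β + C γ * X ^ c

/-- The node polynomial `n = b γ X^c − a β` (`= X·m′ − a·m`; its positive root is the node of the well). -/
def nPoly (a b c : ℕ) (β γ : ℝ) : ℝ[X] := C ((b : ℝ) * γ) * X ^ c - C ((a : ℝ) * β)

/-- The tie quadratic form `q = m² − 2cos(πa/c)·X^a·m + X^{2a}` (`= |g(e^{iπ/c} x)|²` for real `x`, `g(ζ) = γζ^c + ζ^a − β`). -/
def qPoly (a c : ℕ) (β γ : ℝ) : ℝ[X] :=
  mPoly c β γ ^ 2 - C (2 * Real.cos (Real.pi * a / c)) * X ^ a * mPoly c β γ + X ^ (2 * a)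

/-- `M_T = Σ_f w_f · n_f · ∏_{f' ≠ f} q_{f'}` for `T` wells `(β_f, γ_f)` with weights `w_f`, shape `(a, b)`, `c = a + b`. -/
def tieM (a b : ℕ) {T : ℕ} (β γ w : Fin T → ℝ) : ℝ[X] :=
  ∑ f, C (w f) * nPoly a b (a + b) (β f) (γ f) * ∏ f' ∈ Finset.univ.erase f, qPoly a (a + b) (β f') (γ f')

open Classical in
/-- **The tie law** (pen val-idea-25 g8 NOTE §45 (ii); PAPER theorem, refereed PASS by val-idea-crit-1 g10 #356, val-idea-crit-2 g7 #98
and val-lit-p3 g22; NOT yet a kernel theorem — tagged `@[conjecture]` as the obligation node a future `theorem tieLaw : Statement`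
discharges): for coprime `1 ≤ a < b` and positive wells and weights, `M_T` has at most `2T − 1` positive roots counted with
multiplicity (`Polynomial.roots` is the root multiset).  For `T = 0` the statement is vacuous (`tieM = 0`, `roots 0 = 0`,
`2·0 − 1 = 0` in `ℕ`).  `Nat.Coprime a b` is the LINE's normalisation and is not used by the paper proof. -/
@[conjecture] def Statement : Prop :=
  ∀ (a b : ℕ), 0 < a → a < b → Nat.Coprime a b →
    ∀ (T : ℕ) (β γ w : Fin T → ℝ), (∀ f, 0 < β f) → (∀ f, 0 < γ f) → (∀ f, 0 < w f) →
      Multiset.card ((tieM a b β γ w).roots.filter (fun t => 0 < t)) ≤ 2 * T - 1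

end

end TieLaw

end Summit.ValiantsHypothesis.ValiantsHypothesis.Theorems.LacunarySymmetroidMatrixDescartes
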